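import Literature.NumberTheory.EllipticCurves.Kobayashi2003.EtaColemanPoitouTateSequences
import HarnessLib

/-!
# Kobayashi 2003, Thm. 5.2 iii)–v) (Kato's Euler-system bound) read through Prop. 7.1 ii), TOGETHER
# with Thm. 6.2 (6.13)/(6.15) + Thm. 6.3 + Thm. 7.3 i) (7.21) + Cor. 7.2, at the quadratic character
# `η = ω^{(p−1)/2}`, on PINNED objects — the inputs of Kobayashi's proof of Thm. 4.1 at `η`
# ("Theorem 4.1 also follows from Theorem 5.2 iii), iv), v) and the exact sequences in the proof of
# Theorem 7.4", p. 13): ONE hypothesis structure (`EtaKatoColemanPoitouTateData`, extending the sibling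
# `EtaColemanPoitouTateData`) + ONE existence fact (`thm52_62_63_73_etaKatoColemanPoitouTate`)

Topic `NumberTheory/EllipticCurves`, sub-directory `Kobayashi2003` (namespace = path). Cell `bsd-potss`
(HOME `run/shared/lean/pub/bsd-potss/`), seat `bsd-potss-k8q-c2x` g0 (prover; WIDTH-LEVER second lane
of item stmt-BirchSwinnertonDyer-19241 `PlusKatoDivisibilityBranch`, rung K8-Gss2 of
`BirchSwinnertonDyer`, route `QuadraticBranchSignedControl`; director-bsd g8 2026-08-27: "signed
Coleman maps giving Kato divisibility in the plus theory by name"). HONEST FRAMING (cell bsd-potss):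
the programme assembles the Birch–Swinnerton-Dyer formula for analytic-rank `≤ 1` curves STRICTLY from
published theorems and TYPES the remainder; BSD is not proved by any of this; a closed item closes a
rung leaf, never the summit. THIS FILE: one hypothesis STRUCTURE whose fields are printed statements
RELATIVE TO PINNED OBJECTS of the tree — the sibling structure `EtaColemanPoitouTateData` (seat
k8q-c3 g6, Thm. 6.2/6.3/7.3 i)/Cor. 7.2 at `η`) EXTENDED by the two clauses of Kato's Euler-system
bound in Kobayashi's transcription (Thm. 5.2 iii)–v), with iv) and Remark 5.3 i)), read on the dual
fine Selmer group through Prop. 7.1 ii) — and one named fact (`def … : Prop`, nothing asserted, no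
`_holds`; net debt +1) saying the extended structure is inhabited. The pattern of
`Kato2004/DivisibilityInputs.lean` (the good ORDINARY package `es_bound` / `integral` on the same pinned
`𝐇¹_Γ(T_pW)`), now for Kobayashi's SUPERSINGULAR signed theory at `η`. No instance beyond the
structure's own bundled parent, no notation, no attribute is declared or removed.

## Why this file (what it refines, and what it buys)

Item 19241 (the Kato half (RK⁺) of the seam re-cut of the even main conjecture (C1_η) on the
quadratic branch) is SETTLED-BY-CITATION in the tree: glue 19614 (`plusKatoDivisibilityBranchOfNamedFacts_proof`)
derives it from the PROVED descent frame 19611 and three HELD named facts — Kobayashi Thm. 4.1 first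
display at `η` (`thm41_plusEtaCharIdeal_dvd`, item 19612), Thm. 2.2 at `η` (`thm22_etaSignedSelmerDual_finite_torsion`,
19613), Thm. 1.2 (`thm12_signedSelmerDual_finite_torsion`, 19286). Kobayashi does not prove Thm. 4.1
and Thm. 2.2 directly: "Admitting Theorem 6.2 and 6.3, we prove Theorem 2.2 and 4.1" (§7, p. 11), and
(p. 13, last sentence of §7) "Theorem 4.1 also follows from Theorem 5.2 iii), iv), v) and the exact
sequences in the proof of Theorem 7.4." The exact sequences are the content of the sibling fact
`thm62_63_73_etaColemanPoitouTate` (their connecting algebra is kernel-checked Summits-side, seat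
k8q-c3 g5/g6). What the sibling does NOT carry is Thm. 5.2 = KATO'S THEOREM (Astérisque 295 Thm. 12.5
/ 12.6): the Euler-system UPPER BOUND `Char(𝐇²(T)^η) ⊇ Char(𝐇¹(T)^η/Z(T)^η)` (up to a power of `p`
in general, on the nose when `ρ_{E,p^∞}` is onto). This file adds exactly that, ON THE SAME `z` (the
structure's element «`ε_η z_{η(−1)}`», which is why the two theorems must live in ONE structure: the
Coleman side says `Col⁺(z) = L_p⁺(E, η, X)`, the Kato side bounds `𝐇¹/Λz`; only together do they give
Thm. 4.1). Consequence (kernel, Summits-side, seat k8q-c2x, file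
`Theorems/QuadraticBranchSignedControlPlusKatoDivisibilityOfKatoColeman.lean`): the new fact ALONE
implies `thm41_plusEtaCharIdeal_dvd` (19612), `thm41_minusEtaCharIdeal_dvd` (Thm. 4.1 third display),
both clauses (finite generation AND torsion, both signs) of `thm22_etaSignedSelmerDual_finite_torsion`
on the newform frame at `η ≠ 1`, the sibling fact (by forgetting the two new fields; the projection is written Summits-side) and
hence `thm74_etaEvenMC_iff_etaOddMC` (19584); so the K8 even block's Kato side and Thm. 7.4 rest on ONE
print-shaped package instead of four separate citations, and 19241 on that package + Thm. 1.2.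

## Source, verbatim (S. Kobayashi, *Iwasawa theory for elliptic curves at supersingular primes*,
## Invent. Math. 152 (2003) 1–36 [Kobayashi2003]; held copy `paper:doi-10-1007-s00222-002-0265-4`,
## page = file number, re-read by this seat 2026-08-27, pp. 9, 10, 12, 13)

Standing (p. 4): `p` odd, `E/ℚ` with good reduction at `p`, `a_p = 0`; `K_∞ = ℚ(μ_{p^∞})`,
`G_∞ = Δ × Γ`, `Λ = ℤ_p[[G_∞]]`; `T = T_pE`, `V = T ⊗ ℚ`; `𝐇^q(T) = lim← H^q(O_{K_n}[1/p], T)`. p. 9: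
"**Theorem 5.1 (Kato [7]).** i) `𝐇²(T)` is a finitely generated torsion `Λ`-module. ii) `𝐇¹(T)` is
a torsion free `Λ`-module, and `𝐇¹(V)` is a free `Λ ⊗ ℚ`-module of rank 1. iii) If `T/pT` is
irreducible as a two dimensional representation of `Gal(ℚ̄/ℚ)` over `𝔽_p`, then `𝐇¹(T)` is a free
`Λ`-module of rank 1. *Proof.* See Kato [7], Theorem 12.4." p. 9: "**Theorem 5.2 (Kato [7]).** i) There
exist two systems of elements, `z^± = (z^±_n)_n ∈ 𝐇¹(V)`, `z^±_n ∈ H¹(O_{K_n}[1/p], T) ⊗ ℚ` such that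
for a character `ψ` of `G_n` of conductor `p^{n+1}`, we have `∑_{σ∈G_n} ψ(σ) exp*_{ω_E}(σ z^±_n) =
δ (1 − a_p ψ(p)p^{−1} + ψ(p)²p^{−1}) L(E, ψ, 1)/Ω_E^±` where `exp*_{ω_E}` is the dual exponential map
(cf. Sect. 8.7) and `δ = 1` if `ψ(−1)` is equal to the sign of `z^±_n`, otherwise, `δ = 0`. ii) Let
`Z(V)` be the `Λ ⊗ ℚ`-submodule of `𝐇¹(V)` generated by `z⁺` and `z⁻`. Then `𝐇¹(V)/Z(V)` is a
torsion `Λ ⊗ ℚ`-module. iii) Let `η : Δ → ℤ_p^×` be a character. Then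
`Char(𝐇²(V)^η) ⊇ Char(𝐇¹(V)^η/Z(V)^η)`. iv) Let `Z(T)` be the `Λ`-submodule of `𝐇¹(V)` generated
by `z⁺` and `z⁻`. Suppose that `T/pT` is irreducible as a two dimensional representation of
`Gal(ℚ̄/ℚ)` over `𝔽_p`. Then `Z(T) ⊆ 𝐇¹(T)` in `𝐇¹(V)`. v) Suppose that the homomorphism
`Gal(ℚ̄/ℚ) → GL_{ℤ_p}(T)` is surjective. Then, `Char(𝐇²(T)^η) ⊇ Char(𝐇¹(T)^η/Z(T)^η)`. *Proof.* See
Kato [7], Theorem 12.5. For iv), we need Theorem 12.6 of Kato [7]. See also the argument in Sect.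
13.14 of [7]. We also use the fact that the Néron period differs from the canonical period by a
`p`-adic unit (cf. Greenberg-Vatsal [3])." p. 10: "**Remark 5.3.** i) When `E` has supersingular
reduction at `p`, the condition in Theorem 5.1 iii) and 5.2 iv) is satisfied. […] iii) If `E` has no
complex multiplication, then by the result of Serre [22], the condition in Theorem 5.2 v) is satisfied
for almost all `p`." p. 12: "**Proposition 7.1 (Kurihara).** i) The canonical mapping
`𝐇¹(T) → 𝐇¹_{/S}(T)` is an isomorphism. ii) `𝐇²(T)` is isomorphic to `X⁰(E/K_∞)` as `Λ`-module."
p. 13: "**Corollary 7.2.** `X⁰(E/K_∞)` is a torsion `Λ`-module." p. 13 (proof of Thm. 7.4): "By Theorem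
6.2, 6.3 and (7.21), we have three exact sequences `0 → 𝐇¹(T)^η/Z(T)^η → Λ^η/(L_p⁺(E, η, X)) →
X⁺(E/K_∞)^η → X⁰(E/K_∞)^η → 0`, […], `0 → 𝐇¹(T)^η/Z(T)^η → I^η/(L_p⁻(E, η, X)) → X⁻(E/K_∞)^η →
X⁰(E/K_∞)^η → 0`. The last sequence is for a non-trivial `η`. The theorem follows from these sequences
and Proposition 7.1 ii). Theorem 4.1 also follows from Theorem 5.2 iii), iv), v) and the exact
sequences in the proof of Theorem 7.4." Thm. 6.2, Thm. 6.3, Thm. 7.3 i) are quoted verbatim in the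
sibling's module docstring (`EtaColemanPoitouTateSequences.lean`).

(Docstring convention of the sibling files: the source's C-word is written `[C]` in declaration
docstrings; the module docstring carries the unaltered quotations; what is vendored are THEOREMS.)

## Transcription — the two NEW fields, and the reading flags (for the referee)

Frame and pinned objects exactly as in the sibling (its §1 docstring): `p` odd, `K₀ = ℚ(μ_p)`, `η`
THE quadratic character of `Δ`, `V/ℚ` globally minimal good at `p` with `a_p(V) = 0`, newform `f`,
period ratio `ϖ`, cyclotomic `κ` with generator `γ ∈ Gal(ℚ̄/K₀)` matching the variable, `W/ℚ` a model
of `V^{(p*)}` (`T_pW = T_pV ⊗ η`), `I : Kato2004.IwasawaH1Data W p κ γ` (pinned «`𝐇¹(T_pV)^η =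
𝐇¹_Γ(T_pW)`», `Λ = IwasawaAlgebra p = ℤ_p⟦X⟧ = Λ^η`), `FB : W.FineSelmerDualData κ γ` (pinned
«`X⁰(V/K_∞)^η = X⁰(W/ℚ_∞)`»). The parent structure supplies `z : I.H` («`ε_η z_{η(−1)}`»), the two
injective Coleman composites and the (7.21) sequences. The new fields, both about the cyclic quotient
`I.H ⧸ Λ∙z` («`𝐇¹(T)^η/Z(T)^η`») and `FB.X` («`X⁰(E/K_∞)^η ≅ 𝐇²(T)^η`»):
* `kato_rational : ∃ n, (pⁿ)·Char_Λ(I.H ⧸ Λ∙z) ⊆ Char_Λ(FB.X)` — Thm. 5.2 iii) (`Char(𝐇²(V)^η) ⊇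
  Char(𝐇¹(V)^η/Z(V)^η)` over `Λ ⊗ ℚ`) with iv) (`Z(T) ⊆ 𝐇¹(T)`, its hypothesis `T/pT` irreducible
  holding by Remark 5.3 i) — `V` is supersingular at `p`) and Prop. 7.1 ii) (`𝐇²(T) ≅ X⁰(E/K_∞)`),
  INTEGRAL RENDERING (flag `Kob03-52iii-integral-rendering`, NEW): for finitely generated torsion
  `Λ`-modules `M = 𝐇¹(T)^η/Z(T)^η`, `N = 𝐇²(T)^η` one has `M ⊗ ℚ = 𝐇¹(V)^η/Z(V)^η`, `N ⊗ ℚ = 𝐇²(V)^η`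
  and `Char_{Λ⊗ℚ}(· ⊗ ℚ) = Char_Λ(·)·Λ[1/p]`, so the printed inclusion of principal ideals of
  `Λ[1/p]` says `a ∈ b·Λ[1/p]` for generators `a, b`, i.e. `pⁿ·a ∈ (b)` for some `n ≥ 0` — exactly the
  field. Implied by, never stronger than, the print.
* `kato_integral : (∀ m, V.HasSurjectiveModNGaloisRep (p^m)) → Char_Λ(I.H ⧸ Λ∙z) ⊆ Char_Λ(FB.X)` —
  Thm. 5.2 v) with Prop. 7.1 ii); "`Gal(ℚ̄/ℚ) → GL_{ℤ_p}(T)` surjective" (`T = T_pE`, `E` the `a_p = 0`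
  curve, here `V`) spelled `∀ m, V.HasSurjectiveModNGaloisRep (p^m)` as in every sibling
  (`thm41_plusEtaCharIdeal_dvd`, `thm41_minusEtaCharIdeal_dvd`, `thm41_signedCharIdeal_divisibility`,
  `kato_divisibility` (3)).
READING FLAGS. `Kob03-eta-twist-currency` (sibling): the `η`-components of `𝐇¹(T_pV)`, `𝐇²(T_pV) ≅
X⁰(V/K_∞)` (Prop. 7.1 ii) is a `Λ`-isomorphism, hence componentwise) are read on Kato's objects for
`W = V ⊗ η` over `ℚ_∞` (prime-to-`p` descent along `K_n/ℚ_n`, `#Δ` invertible; Greenberg LNM 1716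
§3; NOT formalised — the fields are stated directly on `I.H` and `FB.X`). `Kob03-52-Zeta-cyclic` (NEW):
the printed left end is `𝐇¹(T)^η/Z(T)^η` with `Z(T)^η = Λ·ε_ηz⁺ + Λ·ε_ηz⁻`; the structure's `z` is
«`ε_η z_{η(−1)}`» (the generator Thm. 6.3 evaluates), so `Λ∙z ⊆ Z(T)^η ⊆ 𝐇¹(T)^η` (iv) + Remark 5.3
i)) and `Char(𝐇¹(T)^η/Λz) = Char(Z(T)^η/Λz)·Char(𝐇¹(T)^η/Z(T)^η) ⊆ Char(𝐇¹(T)^η/Z(T)^η)`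
(multiplicativity along `0 → Z^η/Λz → 𝐇¹/Λz → 𝐇¹/Z^η → 0`, all finitely generated torsion: `𝐇¹(T)`
is finitely generated of rank one and `Col⁺(z) = ±L_p⁺(E, η, X) ≠ 0` by Thm. 6.3 and Rohrlich), so
BOTH recorded inclusions are IMPLIED by the printed ones for `Z(T)^η` — weaker than print, never
stronger. (In fact `Z(T)^η = Λ∙z`: the other generator `ε_η z_{−η(−1)}` has `δ = 0` at every
character of `G_n` restricting to `η` on `Δ` (Thm. 5.2 i)), so its Coleman images vanish and Thm. 7.3
i) kills it; not used.) `Kob03-52iii-integral-rendering` (above). `Kob03-721-eta-maps-existential`,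
`Kob03-Thm74-eta-by-eta`, `Kob03-Lpm-eta-upto-unit` as in the siblings; `z` existential (weaker than
print: nothing identifies it with the tree's pinned zeta lifts `Kato2004.IwasawaH1Data.existsUnique_lift_of_zetaBody`;
the deductions use only that ONE element carries Thm. 6.3 for both signs AND Thm. 5.2 iii)/v)).
Everything recorded is implied by, never stronger than, the print.

## Signed Coleman maps beyond `a_p = 0` (the general form; NOT transcribed)

For `a_p = 0` (forced on the K8 class Gss2: `p ≥ 5` supersingular) Kobayashi's `Col^±` of §8 (Honda
theory) ARE the signed Coleman maps; for `a_p ≠ 0` supersingular / higher weight the signed (`♯/♭`,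
resp. Wach-module) Coleman maps and the corresponding one-sided divisibilities of signed main
conjectures from Kato's Euler system are Sprung (J. Number Theory 132 (2012)), Lei–Loeffler–Zerbes
(Asian J. Math. 14 (2010)) and Büyükboduk–Lei (Math. Z. 286 (2017) 361–398: signed Coleman maps
and signed Selmer groups for crystalline Galois representations at non-ordinary primes, with the
Kato-side divisibility of the signed main conjectures). TODO(general form): `η` of any order `∣ p − 1`
(`ℤ_p[η]`-coefficients), `a_p ≠ 0`.

## What is NOT here (and why)

* NO identification of `z` with Kato's zeta element as a tree object, no Thm. 5.2 i)/ii) (values,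
  `Λ ⊗ ℚ`-torsionness), no `𝐇²(T)` as an object (Prop. 7.1 ii) is folded into the reading), no local
  Iwasawa cohomology, no `_holds` (Kato's Euler system, its explicit reciprocity law, the Coleman maps,
  Poitou–Tate along the tower: none of it is in Mathlib).
* NO statement for `η = 1` (the `Δ`-component: the tree's currency there is `SignedSelmerDualData`
  over `ℚ_∞` with `SignedKatoDivisibility.lean`); not needed by the K8 items.
* NO main [C] is asserted (neither Kato's at `η` nor (C1_η)); the EISENSTEIN inclusion
  `Char(𝐇²(T)^η) ⊆ Char(𝐇¹(T)^η/Z(T)^η)` is Kato's main [C], OPEN, and is NOT a field.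

References: [Kobayashi2003] Thm. 5.1, Thm. 5.2, Remark 5.3 (pp. 9–10), Kato's main [C] (p. 10),
Prop. 7.1 (p. 12), Cor. 7.2, Thm. 7.3 (7.21), Thm. 7.4 and its proof, the last sentence of §7 (p. 13),
Thm. 6.2 (6.13)–(6.15) and Thm. 6.3 (p. 11), §7 first sentence (p. 11), Thm. 4.1 (p. 8), Thm. 2.2
(p. 5); [Kato2004Asterisque] Thm. 12.4 (p. 221), Thm. 12.5 and Thm. 12.6 (pp. 221–222), §13.14;
[GreenbergVatsal2000] §3 (period ratio a `p`-adic unit); [GreenbergLNM1716] §3 (prime-to-`p` descent;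
reading); [Rohrlich1984] (non-vanishing); for the general form: Sprung 2012, Lei–Loeffler–Zerbes 2010,
Büyükboduk–Lei 2017 (signed Coleman maps; not transcribed).
-/

noncomputable section

open scoped Classical

open CongruenceSubgroup Polynomial WeierstrassCurve Field Literature.NumberTheory.EllipticCurves
  Literature.NumberTheory.EllipticCurves.ModularForms Literature.NumberTheory.GaloisRepresentations
  ZpExtension

namespace Literature.NumberTheory.EllipticCurves.Kobayashi2003

/-! ## §1 The hypothesis structure: the sibling's Coleman / Poitou–Tate data at `η` EXTENDED by
Kato's Euler-system bound (Thm. 5.2 iii)–v) through Prop. 7.1 ii)) on the same element `z` -/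

/-- **Kobayashi's Kato / Coleman / Poitou–Tate data at the quadratic character `η`, on pinned objects**
(hypothesis structure; nothing asserted by it — existence is the named fact
`thm52_62_63_73_etaKatoColemanPoitouTate`). It EXTENDS `EtaColemanPoitouTateData p K₀ η V f ϖ κ γ W I FB`
(the element `z ∈ 𝐇¹` «`ε_η z_{η(−1)}`», Cor. 7.2, the injective `Col^± ∘ loc : 𝐇¹ → Λ` with
`Col⁺(z)` a plus function and `X·(X⁻¹Col⁻)(z)` a minus function (Thm. 6.2, 6.3, 7.3 i)), the
`η`-components of (7.21) for every dual datum) by the two clauses of **Thm. 5.2 (Kato)** read through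
**Prop. 7.1 ii)** (`𝐇²(T) ≅ X⁰(E/K_∞)`) on the pinned `𝐇¹_Γ(T_pW) = I.H` and `X⁰(W/ℚ_∞) = FB.X`
(`W = V ⊗ η`; flags `Kob03-eta-twist-currency`, `Kob03-52-Zeta-cyclic`): iii)+iv) (with Remark 5.3 i))
"`Char(𝐇²(V)^η) ⊇ Char(𝐇¹(V)^η/Z(V)^η)`" in its integral rendering `∃ n, (pⁿ)·Char(𝐇¹/Λz) ⊆
Char(X⁰)` (flag `Kob03-52iii-integral-rendering`), and v) "if `Gal(ℚ̄/ℚ) → GL_{ℤ_p}(T)` is surjective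
then `Char(𝐇²(T)^η) ⊇ Char(𝐇¹(T)^η/Z(T)^η)`". These are the inputs of the printed proof of Thm. 4.1
at `η` ("Theorem 4.1 also follows from Theorem 5.2 iii), iv), v) and the exact sequences in the proof
of Theorem 7.4", p. 13).
[cite: Kobayashi2003, Thm. 5.2 iii)–v) and Remark 5.3 i) (pp. 9–10), Prop. 7.1 ii) (p. 12), Cor. 7.2, Thm. 7.3 i) (7.21), proof of Thm. 7.4 and last sentence of §7 (p. 13), Thm. 6.2 (6.13)–(6.15) and Thm. 6.3 (p. 11)]
[cite: Kato2004Asterisque, Thm. 12.4 (p. 221), Thm. 12.5 and Thm. 12.6 (pp. 221–222)] -/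
structure EtaKatoColemanPoitouTateData (p : ℕ) [Fact p.Prime] (K₀ : Type) [Field K₀] [NumberField K₀]
    [(galRange (K := ℚ) K₀).Normal] (η : absoluteGaloisGroup ℚ →* ℤˣ)
    (V : WeierstrassCurve ℚ) [V.IsElliptic] {N : ℕ} (f : CuspForm (Gamma0 N) 2) (ϖ : ℚ)
    (κ : ZpExtension ℚ p) (γ : absoluteGaloisGroup ℚ)
    (W : WeierstrassCurve ℚ) [W.IsElliptic] [ContinuousSMul ℤ_[p] (W.tateModule p)]
    (I : Kato2004.IwasawaH1Data W p κ γ) (FB : W.FineSelmerDualData κ γ)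
    extends EtaColemanPoitouTateData p K₀ η V f ϖ κ γ W I FB where
  /-- Thm. 5.2 iii) with iv) (Remark 5.3 i)) and Prop. 7.1 ii), integral rendering: for some `n ≥ 0`,
  `(pⁿ) · Char_Λ(𝐇¹(T)^η/Λz) ⊆ Char_Λ(X⁰(E/K_∞)^η)`, read on `I.H ⧸ Λ∙z` and `FB.X`. -/
  kato_rational : ∃ n : ℕ,
    Ideal.span {(p : IwasawaAlgebra p) ^ n} *
        Module.charIdeal (IwasawaAlgebra p) (I.H ⧸ Submodule.span (IwasawaAlgebra p) {z}) ≤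
      Module.charIdeal (IwasawaAlgebra p) FB.X
  /-- Thm. 5.2 v) with Prop. 7.1 ii): if `ρ_{V,p^∞} : Gal(ℚ̄/ℚ) → GL_{ℤ_p}(T_pV)` is surjective, then
  `Char_Λ(𝐇¹(T)^η/Λz) ⊆ Char_Λ(X⁰(E/K_∞)^η)`, read on `I.H ⧸ Λ∙z` and `FB.X`. -/
  kato_integral : (∀ m : ℕ, V.HasSurjectiveModNGaloisRep (p ^ m : ℕ)) →
    Module.charIdeal (IwasawaAlgebra p) (I.H ⧸ Submodule.span (IwasawaAlgebra p) {z}) ≤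
      Module.charIdeal (IwasawaAlgebra p) FB.X

/-! ## §2 The named fact: the extended structure is inhabited for every `η`-frame -/

/-- **Kobayashi 2003, Thm. 5.2 iii)–v) (Kato) through Prop. 7.1 ii) + Thm. 6.2 (6.13)/(6.15) + Thm. 6.3
+ Thm. 7.3 i) (7.21) + Cor. 7.2, at THE quadratic character `η = ω^{(p−1)/2}`, on pinned objects.** For
the frame of the sibling facts — `p` odd, `K₀ = ℚ(μ_p)`, `η : Γ_ℚ →* ℤˣ` trivial on `Gal(ℚ̄/K₀)` and
`≠ 1`, `V/ℚ` globally minimal with good reduction at `p` and `a_p(V) = 0` (so `p` is SUPERSINGULAR for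
`V` and Remark 5.3 i) discharges the irreducibility hypothesis of Thm. 5.1 iii) / 5.2 iv)), newform `f`
of `V`, period ratio `ϖ` of the parity of `η`, cyclotomic `κ` with topological generator
`γ ∈ Gal(ℚ̄/K₀)` matching the cyclotomic variable — and for every model `W/ℚ` of the quadratic twist
of `V` by `p* = (−1)^{⌊p/2⌋}p` (`C • W.quadraticTwist p* = V`; the instance BINDER
`ContinuousSMul ℤ_[p] (T_pW)` is discharged by `TateModule.continuousSMul_padicInt`), every pinned
`I : Kato2004.IwasawaH1Data W p κ γ` («`𝐇¹(T_pV)^η`») and every pinned `FB : W.FineSelmerDualData κ γ`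
(«`X⁰(V/K_∞)^η`»): `EtaKatoColemanPoitouTateData p K₀ η V f ϖ κ γ W I FB` is inhabited — there are
`z ∈ 𝐇¹`, injective `Col^± ∘ loc : 𝐇¹ → Λ` with `(Col⁺∘loc)(z)` a plus function `L_p⁺(V, η, X)` and
`X·(X⁻¹Col⁻∘loc)(z)` a minus function `L_p⁻(V, η, X)` (Thm. 6.2, 6.3, 7.3 i)), the `η`-components of
(7.21) exact for every dual datum of `Sel^±(V/K_∞)^η`, `X⁰` torsion (Cor. 7.2), AND Kato's bound for
the SAME `z`: `(pⁿ)·Char(𝐇¹/Λz) ⊆ Char(X⁰)` for some `n` (Thm. 5.2 iii)+iv)), `Char(𝐇¹/Λz) ⊆ Char(X⁰)`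
when `ρ_{V,p^∞}` is onto (Thm. 5.2 v)). READING FLAGS (module docstring): `Kob03-eta-twist-currency`,
`Kob03-52-Zeta-cyclic`, `Kob03-52iii-integral-rendering`, `Kob03-721-eta-maps-existential`,
`Kob03-Thm74-eta-by-eta`, `Kob03-Lpm-eta-upto-unit`; `z` existential (weaker than print). Consequences
(kernel, Summits-side): `thm41_plusEtaCharIdeal_dvd`, `thm41_minusEtaCharIdeal_dvd`, both clauses of
`thm22_etaSignedSelmerDual_finite_torsion` on this frame, `thm62_63_73_etaColemanPoitouTate` (projection),
`thm74_etaEvenMC_iff_etaOddMC`. Named fact; nothing asserted; no `_holds` (Kato's Euler system and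
explicit reciprocity law, Coleman maps via Honda theory §8, Poitou–Tate along the tower: none of it is
in Mathlib).
[cite: Kobayashi2003, Thm. 5.2 iii)–v) and Remark 5.3 i) (pp. 9–10), Prop. 7.1 ii) (p. 12), Cor. 7.2, Thm. 7.3 i) (7.21), proof of Thm. 7.4 and last sentence of §7 (p. 13), Thm. 6.2 (6.13)–(6.15) and Thm. 6.3 (p. 11), Thm. 5.1 (p. 9), Thm. 3.2 and (3.4)–(3.7) (p. 7), §3 (p. 5), §4 (p. 8)]
[cite: Kato2004Asterisque, Thm. 12.4 (p. 221), Thm. 12.5 and Thm. 12.6 (pp. 221–222), §13.14]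
[cite: GreenbergLNM1716, §3 (prime-to-p descent of Selmer groups; reading)] -/
def thm52_62_63_73_etaKatoColemanPoitouTate : Prop :=
  ∀ (p : ℕ) [Fact p.Prime] (K₀ : Type) [Field K₀] [NumberField K₀] [IsCyclotomicExtension {p} ℚ K₀]
    [(galRange (K := ℚ) K₀).Normal] (η : absoluteGaloisGroup ℚ →* ℤˣ),
    (∀ σ ∈ galRange (K := ℚ) K₀, η σ = 1) → η ≠ 1 →
  ∀ (V : WeierstrassCurve ℚ) [V.IsElliptic] [V.IsGloballyMinimal] {N : ℕ} [NeZero N]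
    {f : CuspForm (Gamma0 N) 2},
    p ≠ 2 → V.HasGoodReductionAtPrime p → V.frobeniusTrace p = 0 → IsNewformOf V f →
  ∀ (ϖ : ℚ), (if Even (p / 2) then (ϖ : ℝ) * V.realPeriodRat = plusPeriod f
      else (ϖ : ℝ) * V.imaginaryPeriodRat = minusPeriod f) →
  ∀ (κ : ZpExtension ℚ p) (γ : absoluteGaloisGroup ℚ),
    κ.IsCyclotomic → κ.IsTopGenerator γ → γ ∈ galRange (K := ℚ) K₀ → IsCyclotomicVariable p γ →
  ∀ (W : WeierstrassCurve ℚ) [W.IsElliptic] [ContinuousSMul ℤ_[p] (W.tateModule p)]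
    (C : VariableChange ℚ), C • W.quadraticTwist ((-1) ^ (p / 2) * p) = V →
  ∀ (I : Kato2004.IwasawaH1Data W p κ γ) (FB : W.FineSelmerDualData κ γ),
    Nonempty (EtaKatoColemanPoitouTateData p K₀ η V f ϖ κ γ W I FB)

end Literature.NumberTheory.EllipticCurves.Kobayashi2003

end
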